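import Summits.QuantumFields.YangMills.Theorems.SwapVirialDeficitSectorLaplaceTipFibre
import Summits.QuantumFields.YangMills.Theorems.SwapVirialDeficitBlowUpGnomonicCrossFloor
import HarnessLib

/-!
# Route `SwapVirialDeficit` (YangMills): THE TIP FIBRE BOUND PER LEADER POINT WITH A GENERIC LEADER FLOOR (hCore S1″; frame-independent)
# (cell ym-idea-1, skeleton ➎, `stub_core_tip`, the core; free-hands support of ⟨stmt-QuantumFields-24197⟩ `SwapVirialDeficit.SwapGluedStiffness`)

✓`tipFibre_le` (w2 g61) bounds the follower integral over a leader point `ℓ = ((x,y),(z,0))` of the tip hub with the rate `e^{−(b∕7200L⁶)·Four(ℓ)}` of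
✓`tip_four_floor`.  The assembly (either frame: caps (B5) or aligned) wants OTHER leader floors in the exponent (the full cross floor ✓`gnoDeficit_floor_cross`,
the soft pair floor, cap floors).  Here the same theorem for an ARBITRARY leader floor `Λ`, i.e. any real with `Λ ≤ F̂(hubAt δ_t 1, ε, ((x,y),(z,F)))` for every
follower configuration `F`:
★★★ `tipFibre_le_of_floor` —
`∫⁻_F e^{−bF̂(hubAt δ_t 1, ε, ((x,y),(z,F)))}·piWeight F ≤ ofReal( e^{−b·Λ}·(e^{3∕2}·Gauss_b∕√det A₀(gnoBase p′) + e^{−bκ_R}·∫piWeight∘blocks) ) + ofReal(e^{−bκ_far})·∫⁻ piWeight`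
(same hypotheses as ✓`tipFibre_le`; near branch ✓`tip_follower_ceiling_mod_rot_group` with `e^{−bF̂(η⋆)} ≤ e^{−bΛ}` since `η⋆ = ℓ + ι y⋆` has the leaders of `ℓ`
(✓`leaderPoint_add_gnoFolEmb`); far branch ✓`tipCore_fibre_far`), and the two-floor corollary
★ `tipFibre_le_four_cross` — `Λ = Four(ℓ)∕(14400L⁶) + Cross(ℓ)∕(3600L⁶)` (`Cross = 4|x×y|²∕((1+|x|²)(1+|y|²))`, ✓`tip_four_floor` + ✓`gnoDeficit_floor_cross`, halves).

HONEST LABEL: composition of landed bricks; the leader layer (S3) and the assembly (S4) of `hubIntegral_hubAt_core_ceiling`, `stub_core_tip`, ⟨24197⟩ ∕ ⟨24194⟩ remain OPEN;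
own crux ⟨22884⟩ `LargeFieldMassRefinementTail` OPEN (blocked-on ⟨19935⟩); the Yang–Mills mass gap is NOT proved; no summit is proved by a line.
THEOREMS ONLY (0 `def`, 0 `sorry`, no instance), standard axioms.  Width seat ym-line-sfw-p2-w2 g61 (cell ym-idea-1, free hands), `--supports stmt-QuantumFields-24197`.
References: [cite: Luscher1983, §2]; [cite: Breitung1994, Lemma 26]; [folklore].
-/

set_option autoImplicit false
set_option synthInstance.maxSize 1024

noncomputable section

open MeasureTheory Quaternion Set Module
open scoped Quaternion BigOperators ENNReal InnerProductSpace
open Literature.MathematicalPhysics.QuantumLattice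
open Literature.MathematicalPhysics.QuantumFieldTheory hiding SU2

namespace Summit.QuantumFields.YangMills.Theorems.SwapVirialDeficit.SectorLaplace

open Summit.QuantumFields.YangMills.Theorems.FemtoTransferGap
open Summit.QuantumFields.YangMills.Theorems.FemtoTransferGap.TT
open Summit.QuantumFields.YangMills.Theorems.VirialFluxGap.RingDeficit
open Summit.QuantumFields.YangMills.Theorems.SwapVirialDeficit.SwapRing
open Summit.QuantumFields.YangMills.Theorems.SwapVirialDeficit.BlowUpRing
open Summit.QuantumFields.YangMills.Theorems.SwapVirialDeficit.Gnomonic (piWeight piWeight_pos piWeight_le_one)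

variable {L : ℕ} [NeZero L]

set_option maxHeartbeats 1600000 in
/-- ★★★ **THE TIP FIBRE BOUND PER LEADER POINT, GENERIC LEADER FLOOR `Λ`** (see the file header). [cite: Luscher1983, §2] [cite: Breitung1994, Lemma 26] -/
theorem tipFibre_le_of_floor {ε : GnoSign L} (hε : GoodSign ε) {δt : ℝ} (hδt : 0 < δt)
    (hwinδ : 122689728 * δt⁻¹ * (L : ℝ) ^ 4 ≤ (2304 * (L : ℝ) ^ 6 * (Fintype.card (Fol L) : ℝ))⁻¹ / (8 * (3 * (Fintype.card (Fol L) : ℝ))))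
    {A0 : GnoCoord L → GnoFol L →ₗ[ℝ] GnoFol L} (hA0s : ∀ η, (A0 η).IsSymmetric)
    (hA0yy : ∀ η (y : GnoFol L), ⟪A0 η y, y⟫_ℝ = iteratedFDeriv ℝ 2 (fun y' : GnoFol L => gnoDeficit z₀ (fun _ => 1) ((1 : ℝ) : ℍ) ε (η + gnoFolEmb y')) 0 (fun _ => y))
    (hA0ray : ∀ η (y : GnoFol L), ⟪A0 η y, y⟫_ℝ = iteratedDeriv 2 (fun s : ℝ => gnoDeficit (fun _ => false) (fun _ => 1) ((1 : ℝ) : ℍ) ε (η + s • gnoFolEmb y)) 0)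
    (hA0amb : ∀ η (y : GnoFol L), ⟪A0 η y, y⟫_ℝ = iteratedFDeriv ℝ 2 (gnoDeficit z₀ (fun _ => 1) ((1 : ℝ) : ℍ) ε) η (fun _ => gnoFolEmb y))
    (x y z : Fin 3 → ℝ) {sT κf : ℝ} (hsT : 0 ≤ sT) (hκf0 : 0 ≤ κf)
    (hs2 : sT ^ 2 ≤ ((2304 * (L : ℝ) ^ 6 * (Fintype.card (Fol L) : ℝ))⁻¹) ^ 2 / (304992000000 * (L : ℝ) ^ 8))
    (hκf : κf ≤ (2304 * (L : ℝ) ^ 6 * (Fintype.card (Fol L) : ℝ))⁻¹ * ((2304 * (L : ℝ) ^ 6 * (Fintype.card (Fol L) : ℝ))⁻¹ / (6 * (2484000 * (L : ℝ) ^ 4))) ^ 2 / 4)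
    (hκwin : 44712000 * (L : ℝ) ^ 4 * Real.sqrt (κf / (2304 * (L : ℝ) ^ 6 * (Fintype.card (Fol L) : ℝ))⁻¹) ≤
      (2304 * (L : ℝ) ^ 6 * (Fintype.card (Fol L) : ℝ))⁻¹ / (8 * (3 * (Fintype.card (Fol L) : ℝ))))
    {u : ℍ} (hu : ‖u‖ = 1) (p' : ℝ × ℝ) {D : ℝ} (hD0 : 0 < D) (hD1 : D ≤ 1)
    (hD : ∀ μ, ‖su2Quat ((blowUpPoint (L := L) 1 (gnomonicPoint ((1 : ℝ) : ℍ) ε (gnoBase p'.1 p'.2))).1 μ) -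
      su2Quat ((blowUpPoint (L := L) 1 (gnomonicPoint ((1 : ℝ) : ℍ) ε (gnoRot (star u) ((((x, y), (z, (0 : Fol L → Fin 3 → ℝ))) : GnoCoord L))))).1 μ)‖ ≤ D)
    (hDwin : 3219264 * (L : ℝ) ^ 4 * D ≤ (2304 * (L : ℝ) ^ 6 * (Fintype.card (Fol L) : ℝ))⁻¹ / (4 * (3 * (Fintype.card (Fol L) : ℝ))))
    {b : ℝ} (hb : 0 < b) (Λ : ℝ) (hΛ : ∀ F : Fol L → Fin 3 → ℝ, Λ ≤ gnoDeficit (fun _ => false) (fun _ => 1) (hubAt δt 1) ε (((x, y), (z, F)) : GnoCoord L)) :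
    ∫⁻ F : Fol L → Fin 3 → ℝ, ENNReal.ofReal (Real.exp (-(b * gnoDeficit (fun _ => false) (fun _ => 1) (hubAt δt 1) ε (((x, y), (z, F)) : GnoCoord L))) * piWeight F) ≤
      ENNReal.ofReal (Real.exp (-(b * Λ)) *
          (Real.exp (3 / 2) * (2 * Real.pi / ((1 - 1 / (2 * (finrank ℝ (GnoFol L) : ℝ))) * b)) ^ ((finrank ℝ (GnoFol L) : ℝ) / 2) /
              Real.sqrt (LinearMap.det (A0 (gnoBase p'.1 p'.2))) +
            Real.exp (-(b * ((2304 * (L : ℝ) ^ 6 * (Fintype.card (Fol L) : ℝ))⁻¹ *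
                (3 * ((2304 * (L : ℝ) ^ 6 * (Fintype.card (Fol L) : ℝ))⁻¹ / 2) / (2 * (finrank ℝ (GnoFol L) : ℝ) * (2484000 * (L : ℝ) ^ 4))) ^ 2 / 4))) *
              ∫ w : GnoFol L, piWeight (gnoFolBlocks w))) +
        ENNReal.ofReal (Real.exp (-(b * (min (sT ^ 2) (κf / (300 * (L : ℝ) ^ 4)) / (3600 * (L : ℝ) ^ 6))))) *
          ∫⁻ F : Fol L → Fin 3 → ℝ, ENNReal.ofReal (piWeight F) := by
  have hL : (0 : ℝ) < (L : ℝ) := Nat.cast_pos.2 (Nat.pos_of_ne_zero (NeZero.ne L))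
  set ℓ : GnoCoord L := (((x, y), (z, (0 : Fol L → Fin 3 → ℝ))) : GnoCoord L) with hℓ
  have hℓF : ℓ.2.2 = 0 := rfl
  -- abbreviations
  set Gb : ℝ := (2 * Real.pi / ((1 - 1 / (2 * (finrank ℝ (GnoFol L) : ℝ))) * b)) ^ ((finrank ℝ (GnoFol L) : ℝ) / 2) with hGb
  set Dref : ℝ := Real.sqrt (LinearMap.det (A0 (gnoBase p'.1 p'.2))) with hDref
  set κR : ℝ := (2304 * (L : ℝ) ^ 6 * (Fintype.card (Fol L) : ℝ))⁻¹ *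
      (3 * ((2304 * (L : ℝ) ^ 6 * (Fintype.card (Fol L) : ℝ))⁻¹ / 2) / (2 * (finrank ℝ (GnoFol L) : ℝ) * (2484000 * (L : ℝ) ^ 4))) ^ 2 / 4 with hκR
  set IW : ℝ := ∫ w : GnoFol L, piWeight (gnoFolBlocks w) with hIW
  set Tfar : ℝ≥0∞ := ENNReal.ofReal (Real.exp (-(b * (min (sT ^ 2) (κf / (300 * (L : ℝ) ^ 4)) / (3600 * (L : ℝ) ^ 6))))) *
    ∫⁻ F : Fol L → Fin 3 → ℝ, ENNReal.ofReal (piWeight F) with hTfar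
  show ∫⁻ F : Fol L → Fin 3 → ℝ, ENNReal.ofReal (Real.exp (-(b * gnoDeficit (fun _ => false) (fun _ => 1) (hubAt δt 1) ε (((x, y), (z, F)) : GnoCoord L))) * piWeight F) ≤
      ENNReal.ofReal (Real.exp (-(b * Λ)) * (Real.exp (3 / 2) * Gb / Dref + Real.exp (-(b * κR)) * IW)) + Tfar
  -- the near ∕ far split
  by_cases hadm : ((∀ μ' ν : Fin 3, frobNorm ((((blowUpPoint 1 (gnomonicPoint (hubAt δt 1) ε ℓ)).1 (Fin.castSucc μ') *
        (blowUpPoint 1 (gnomonicPoint (hubAt δt 1) ε ℓ)).1 (Fin.castSucc ν) : SU2) : Matrix (Fin 2) (Fin 2) ℂ) -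
        (((blowUpPoint 1 (gnomonicPoint (hubAt δt 1) ε ℓ)).1 (Fin.castSucc ν) * (blowUpPoint 1 (gnomonicPoint (hubAt δt 1) ε ℓ)).1 (Fin.castSucc μ') : SU2) :
        Matrix (Fin 2) (Fin 2) ℂ)) ≤ sT) ∧
      (∀ μ' : Fin 3, frobNorm ((((blowUpPoint 1 (gnomonicPoint (hubAt δt 1) ε ℓ)).1 (Fin.last 3) *
        (blowUpPoint 1 (gnomonicPoint (hubAt δt 1) ε ℓ)).1 (Fin.castSucc (Equiv.swap (0 : Fin 3) 1 μ')) : SU2) : Matrix (Fin 2) (Fin 2) ℂ) -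
        (((blowUpPoint 1 (gnomonicPoint (hubAt δt 1) ε ℓ)).1 (Fin.castSucc μ') * (blowUpPoint 1 (gnomonicPoint (hubAt δt 1) ε ℓ)).1 (Fin.last 3) : SU2) : Matrix (Fin 2) (Fin 2) ℂ)) ≤ sT) ∧
      gnoDeficit (fun _ => false) (fun _ => 1) (hubAt δt 1) ε ℓ ≤ κf)
  swap
  · -- FAR
    have hfar := tipCore_fibre_far (L := L) (a := hubAt δt 1) ε hε.2 x y z hsT hκf0 hb.le hadm
    exact hfar.trans le_add_self
  -- NEAR
  obtain ⟨hCC, hσ, hflat⟩ := hadm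
  obtain ⟨ys, hys, hglob, hT1⟩ := tip_follower_ceiling_mod_rot_group hε hδt hwinδ hA0s hA0yy hA0ray hA0amb ℓ hℓF hsT hCC hσ hs2 hκf hflat hu p' hD0 hD1 hD hDwin hκwin
  have hT1b := hT1 b hb
  -- the leader floor at the minimiser `ℓ + ι ys` (its leaders are those of `ℓ`)
  have hΛ' : Λ ≤ gnoDeficit (fun _ => false) (fun _ => 1) (hubAt δt 1) ε (ℓ + gnoFolEmb ys) := by
    rw [hℓ, ← leaderPoint_add_gnoFolEmb]; exact hΛ _
  have hexp : Real.exp (-(b * gnoDeficit (fun _ => false) (fun _ => 1) (hubAt δt 1) ε (ℓ + gnoFolEmb ys))) ≤ Real.exp (-(b * Λ)) :=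
    Real.exp_le_exp.2 (neg_le_neg (mul_le_mul_of_nonneg_left hΛ' hb.le))
  -- the LHS as a Bochner integral over `V_F`
  obtain ⟨hWm, hWpos, hWle, hWint⟩ := folWeight_facts (L := L)
  have hcont : Continuous fun f : GnoFol L => gnoDeficit (fun _ => false) (fun _ => 1) (hubAt δt 1) ε (ℓ + gnoFolEmb f) :=
    (contDiff_gnoDeficit_fol (n := 0) (fun _ => false) (fun _ => (1 : SU2)) (hubAt_one_ne_zero δt) ε ℓ).continuous
  have hint : Integrable fun f : GnoFol L => Real.exp (-(b * gnoDeficit (fun _ => false) (fun _ => 1) (hubAt δt 1) ε (ℓ + gnoFolEmb f))) * piWeight (gnoFolBlocks f) := by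
    refine hWint.mono' ((Real.continuous_exp.comp (hcont.const_mul b).neg).aestronglyMeasurable.mul hWm.aestronglyMeasurable) (ae_of_all _ fun f => ?_)
    rw [Real.norm_eq_abs, abs_of_nonneg (mul_nonneg (Real.exp_pos _).le (hWpos f).le)]
    refine mul_le_of_le_one_left (hWpos f).le ?_
    rw [Real.exp_le_one_iff, neg_nonpos]
    exact mul_nonneg hb.le (gnoDeficit_nonneg _ _ _ _ _)
  have hLHS : ∫⁻ F : Fol L → Fin 3 → ℝ, ENNReal.ofReal (Real.exp (-(b * gnoDeficit (fun _ => false) (fun _ => 1) (hubAt δt 1) ε (((x, y), (z, F)) : GnoCoord L))) * piWeight F) =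
      ENNReal.ofReal (∫ f : GnoFol L, Real.exp (-(b * gnoDeficit (fun _ => false) (fun _ => 1) (hubAt δt 1) ε (ℓ + gnoFolEmb f))) * piWeight (gnoFolBlocks f)) := by
    have hm : Measurable fun F : Fol L → Fin 3 → ℝ =>
        ENNReal.ofReal (Real.exp (-(b * gnoDeficit (fun _ => false) (fun _ => 1) (hubAt δt 1) ε (((x, y), (z, F)) : GnoCoord L))) * piWeight F) := by
      have hc1 : Continuous fun F : Fol L → Fin 3 → ℝ => (((x, y), (z, F)) : GnoCoord L) := by fun_prop
      have hc2 : Continuous fun F : Fol L → Fin 3 → ℝ => gnoDeficit (fun _ => false) (fun _ => 1) (hubAt δt 1) ε (((x, y), (z, F)) : GnoCoord L) :=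
        (Gnomonic.contDiff_gnoDeficit (n := 0) (fun _ => false) (fun _ => (1 : SU2)) (hubAt_one_ne_zero δt) ε).continuous.comp hc1
      exact ENNReal.measurable_ofReal.comp ((Real.continuous_exp.comp (hc2.const_mul b).neg).measurable.mul (Gnomonic.continuous_piWeight.measurable))
    rw [← (volume_preserving_gnoFolBlocksEquiv (L := L)).lintegral_comp hm, ofReal_integral_eq_lintegral_ofReal hint
      (ae_of_all _ fun f => mul_nonneg (Real.exp_pos _).le (hWpos f).le)]
    refine lintegral_congr fun f => ?_
    rw [gnoFolBlocksEquiv_apply, leaderPoint_add_gnoFolEmb]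
  rw [hLHS]
  -- assemble
  have hIW0 : 0 ≤ IW := by rw [hIW]; exact integral_nonneg fun w => (hWpos w).le
  have hd9 := nine_le_finrank_gnoFol (L := L)
  have hd1 : 0 < 1 - 1 / (2 * (finrank ℝ (GnoFol L) : ℝ)) := by rw [sub_pos, div_lt_one (by positivity)]; linarith
  have hGb0 : 0 ≤ Gb := by rw [hGb]; exact Real.rpow_nonneg (div_nonneg (by positivity) (mul_nonneg hd1.le hb.le)) _
  have hDref0 : 0 ≤ Dref := Real.sqrt_nonneg _
  have hK0 : 0 ≤ Real.exp (3 / 2) * Gb / Dref + Real.exp (-(b * κR)) * IW := by positivity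
  have hreal : ∫ f : GnoFol L, Real.exp (-(b * gnoDeficit (fun _ => false) (fun _ => 1) (hubAt δt 1) ε (ℓ + gnoFolEmb f))) * piWeight (gnoFolBlocks f) ≤
      Real.exp (-(b * Λ)) * (Real.exp (3 / 2) * Gb / Dref + Real.exp (-(b * κR)) * IW) := by
    refine hT1b.trans ?_
    have e : Real.exp (-(b * (gnoDeficit (fun _ => false) (fun _ => 1) (hubAt δt 1) ε (ℓ + gnoFolEmb ys) + κR))) =
        Real.exp (-(b * gnoDeficit (fun _ => false) (fun _ => 1) (hubAt δt 1) ε (ℓ + gnoFolEmb ys))) * Real.exp (-(b * κR)) := by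
      rw [← Real.exp_add]; ring_nf
    rw [hκR] at e ⊢
    rw [e, mul_assoc, ← mul_add]
    exact mul_le_mul_of_nonneg_right hexp (by rw [← hκR]; exact hK0)
  calc ENNReal.ofReal (∫ f : GnoFol L, Real.exp (-(b * gnoDeficit (fun _ => false) (fun _ => 1) (hubAt δt 1) ε (ℓ + gnoFolEmb f))) * piWeight (gnoFolBlocks f))
      ≤ ENNReal.ofReal (Real.exp (-(b * Λ)) * (Real.exp (3 / 2) * Gb / Dref + Real.exp (-(b * κR)) * IW)) := ENNReal.ofReal_le_ofReal hreal
    _ ≤ _ := le_self_add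

/-- ★ The two-floor leader floor: `Four(ℓ)∕(14400L⁶) + Cross(ℓ)∕(3600L⁶) ≤ F̂(hubAt δ 1, ε, ((x,y),(z,F)))` for every `F`
(halves of ✓`tip_four_floor` and ✓`gnoDeficit_floor_cross`). [cite: Luscher1983, §2] -/
theorem four_cross_floor (δ : ℝ) (ε : GnoSign L) (x y z : Fin 3 → ℝ) (F : Fol L → Fin 3 → ℝ) :
    (4 * δ ^ 2 * ((1 + δ ^ 2)⁻¹) ^ 2 * ((x 1) ^ 2 + (x 2) ^ 2) / (1 + ((x 0) ^ 2 + (x 1) ^ 2 + (x 2) ^ 2)) +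
          4 * (1 + δ ^ 2)⁻¹ * ((y 1) ^ 2 + (y 2) ^ 2) / (1 + ((y 0) ^ 2 + (y 1) ^ 2 + (y 2) ^ 2)) +
          4 * ((x 2 * y 0 - x 0 * y 2) ^ 2 + (x 0 * y 1 - x 1 * y 0) ^ 2) / ((1 + ((x 0) ^ 2 + (x 1) ^ 2 + (x 2) ^ 2)) * (1 + ((y 0) ^ 2 + (y 1) ^ 2 + (y 2) ^ 2))) +
          ((z 0) ^ 2 + (z 1) ^ 2 + (z 2) ^ 2) / (1 + ((z 0) ^ 2 + (z 1) ^ 2 + (z 2) ^ 2))) / (14400 * (L : ℝ) ^ 6) +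
      4 * ((x 1 * y 2 - x 2 * y 1) ^ 2 + (x 2 * y 0 - x 0 * y 2) ^ 2 + (x 0 * y 1 - x 1 * y 0) ^ 2) /
          ((1 + ((x 0) ^ 2 + (x 1) ^ 2 + (x 2) ^ 2)) * (1 + ((y 0) ^ 2 + (y 1) ^ 2 + (y 2) ^ 2))) / (3600 * (L : ℝ) ^ 6) ≤
      gnoDeficit (fun _ => false) (fun _ => 1) (hubAt δ 1) ε (((x, y), (z, F)) : GnoCoord L) := by
  have hL : (0 : ℝ) < (L : ℝ) := Nat.cast_pos.2 (Nat.pos_of_ne_zero (NeZero.ne L))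
  have h4 : 4 * δ ^ 2 * ((1 + δ ^ 2)⁻¹) ^ 2 * ((x 1) ^ 2 + (x 2) ^ 2) / (1 + ((x 0) ^ 2 + (x 1) ^ 2 + (x 2) ^ 2)) +
          4 * (1 + δ ^ 2)⁻¹ * ((y 1) ^ 2 + (y 2) ^ 2) / (1 + ((y 0) ^ 2 + (y 1) ^ 2 + (y 2) ^ 2)) +
          4 * ((x 2 * y 0 - x 0 * y 2) ^ 2 + (x 0 * y 1 - x 1 * y 0) ^ 2) / ((1 + ((x 0) ^ 2 + (x 1) ^ 2 + (x 2) ^ 2)) * (1 + ((y 0) ^ 2 + (y 1) ^ 2 + (y 2) ^ 2))) +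
          ((z 0) ^ 2 + (z 1) ^ 2 + (z 2) ^ 2) / (1 + ((z 0) ^ 2 + (z 1) ^ 2 + (z 2) ^ 2)) ≤
      7200 * (L : ℝ) ^ 6 * gnoDeficit (fun _ => false) (fun _ => 1) (hubAt δ 1) ε (((x, y), (z, F)) : GnoCoord L) :=
    tip_four_floor (L := L) δ ε (((x, y), (z, F)) : GnoCoord L)
  have hc : 4 * ((x 1 * y 2 - x 2 * y 1) ^ 2 + (x 2 * y 0 - x 0 * y 2) ^ 2 + (x 0 * y 1 - x 1 * y 0) ^ 2) /
        ((1 + ((x 0) ^ 2 + (x 1) ^ 2 + (x 2) ^ 2)) * (1 + ((y 0) ^ 2 + (y 1) ^ 2 + (y 2) ^ 2))) ≤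
      1800 * (L : ℝ) ^ 6 * gnoDeficit (fun _ => false) (fun _ => 1) (hubAt δ 1) ε (((x, y), (z, F)) : GnoCoord L) :=
    gnoDeficit_floor_cross (L := L) (hubAt δ 1) ε (((x, y), (z, F)) : GnoCoord L)
  rw [div_add_div _ _ (by positivity) (by positivity), div_le_iff₀ (by positivity)]
  nlinarith [h4, hc, pow_pos hL 6, pow_pos hL 12]

set_option maxHeartbeats 800000 in
/-- ★ **THE TIP FIBRE BOUND WITH THE FOUR + CROSS FLOOR** (`tipFibre_le_of_floor` at `Λ = Four∕(14400L⁶) + Cross∕(3600L⁶)`). [cite: Luscher1983, §2] [cite: Breitung1994, Lemma 26] -/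
theorem tipFibre_le_four_cross {ε : GnoSign L} (hε : GoodSign ε) {δt : ℝ} (hδt : 0 < δt)
    (hwinδ : 122689728 * δt⁻¹ * (L : ℝ) ^ 4 ≤ (2304 * (L : ℝ) ^ 6 * (Fintype.card (Fol L) : ℝ))⁻¹ / (8 * (3 * (Fintype.card (Fol L) : ℝ))))
    {A0 : GnoCoord L → GnoFol L →ₗ[ℝ] GnoFol L} (hA0s : ∀ η, (A0 η).IsSymmetric)
    (hA0yy : ∀ η (y : GnoFol L), ⟪A0 η y, y⟫_ℝ = iteratedFDeriv ℝ 2 (fun y' : GnoFol L => gnoDeficit z₀ (fun _ => 1) ((1 : ℝ) : ℍ) ε (η + gnoFolEmb y')) 0 (fun _ => y))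
    (hA0ray : ∀ η (y : GnoFol L), ⟪A0 η y, y⟫_ℝ = iteratedDeriv 2 (fun s : ℝ => gnoDeficit (fun _ => false) (fun _ => 1) ((1 : ℝ) : ℍ) ε (η + s • gnoFolEmb y)) 0)
    (hA0amb : ∀ η (y : GnoFol L), ⟪A0 η y, y⟫_ℝ = iteratedFDeriv ℝ 2 (gnoDeficit z₀ (fun _ => 1) ((1 : ℝ) : ℍ) ε) η (fun _ => gnoFolEmb y))
    (x y z : Fin 3 → ℝ) {sT κf : ℝ} (hsT : 0 ≤ sT) (hκf0 : 0 ≤ κf)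
    (hs2 : sT ^ 2 ≤ ((2304 * (L : ℝ) ^ 6 * (Fintype.card (Fol L) : ℝ))⁻¹) ^ 2 / (304992000000 * (L : ℝ) ^ 8))
    (hκf : κf ≤ (2304 * (L : ℝ) ^ 6 * (Fintype.card (Fol L) : ℝ))⁻¹ * ((2304 * (L : ℝ) ^ 6 * (Fintype.card (Fol L) : ℝ))⁻¹ / (6 * (2484000 * (L : ℝ) ^ 4))) ^ 2 / 4)
    (hκwin : 44712000 * (L : ℝ) ^ 4 * Real.sqrt (κf / (2304 * (L : ℝ) ^ 6 * (Fintype.card (Fol L) : ℝ))⁻¹) ≤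
      (2304 * (L : ℝ) ^ 6 * (Fintype.card (Fol L) : ℝ))⁻¹ / (8 * (3 * (Fintype.card (Fol L) : ℝ))))
    {u : ℍ} (hu : ‖u‖ = 1) (p' : ℝ × ℝ) {D : ℝ} (hD0 : 0 < D) (hD1 : D ≤ 1)
    (hD : ∀ μ, ‖su2Quat ((blowUpPoint (L := L) 1 (gnomonicPoint ((1 : ℝ) : ℍ) ε (gnoBase p'.1 p'.2))).1 μ) -
      su2Quat ((blowUpPoint (L := L) 1 (gnomonicPoint ((1 : ℝ) : ℍ) ε (gnoRot (star u) ((((x, y), (z, (0 : Fol L → Fin 3 → ℝ))) : GnoCoord L))))).1 μ)‖ ≤ D)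
    (hDwin : 3219264 * (L : ℝ) ^ 4 * D ≤ (2304 * (L : ℝ) ^ 6 * (Fintype.card (Fol L) : ℝ))⁻¹ / (4 * (3 * (Fintype.card (Fol L) : ℝ))))
    {b : ℝ} (hb : 0 < b) :
    ∫⁻ F : Fol L → Fin 3 → ℝ, ENNReal.ofReal (Real.exp (-(b * gnoDeficit (fun _ => false) (fun _ => 1) (hubAt δt 1) ε (((x, y), (z, F)) : GnoCoord L))) * piWeight F) ≤
      ENNReal.ofReal (Real.exp (-(b * ((4 * δt ^ 2 * ((1 + δt ^ 2)⁻¹) ^ 2 * ((x 1) ^ 2 + (x 2) ^ 2) / (1 + ((x 0) ^ 2 + (x 1) ^ 2 + (x 2) ^ 2)) +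
          4 * (1 + δt ^ 2)⁻¹ * ((y 1) ^ 2 + (y 2) ^ 2) / (1 + ((y 0) ^ 2 + (y 1) ^ 2 + (y 2) ^ 2)) +
          4 * ((x 2 * y 0 - x 0 * y 2) ^ 2 + (x 0 * y 1 - x 1 * y 0) ^ 2) / ((1 + ((x 0) ^ 2 + (x 1) ^ 2 + (x 2) ^ 2)) * (1 + ((y 0) ^ 2 + (y 1) ^ 2 + (y 2) ^ 2))) +
          ((z 0) ^ 2 + (z 1) ^ 2 + (z 2) ^ 2) / (1 + ((z 0) ^ 2 + (z 1) ^ 2 + (z 2) ^ 2))) / (14400 * (L : ℝ) ^ 6) +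
      4 * ((x 1 * y 2 - x 2 * y 1) ^ 2 + (x 2 * y 0 - x 0 * y 2) ^ 2 + (x 0 * y 1 - x 1 * y 0) ^ 2) /
          ((1 + ((x 0) ^ 2 + (x 1) ^ 2 + (x 2) ^ 2)) * (1 + ((y 0) ^ 2 + (y 1) ^ 2 + (y 2) ^ 2))) / (3600 * (L : ℝ) ^ 6)))) *
          (Real.exp (3 / 2) * (2 * Real.pi / ((1 - 1 / (2 * (finrank ℝ (GnoFol L) : ℝ))) * b)) ^ ((finrank ℝ (GnoFol L) : ℝ) / 2) /
              Real.sqrt (LinearMap.det (A0 (gnoBase p'.1 p'.2))) +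
            Real.exp (-(b * ((2304 * (L : ℝ) ^ 6 * (Fintype.card (Fol L) : ℝ))⁻¹ *
                (3 * ((2304 * (L : ℝ) ^ 6 * (Fintype.card (Fol L) : ℝ))⁻¹ / 2) / (2 * (finrank ℝ (GnoFol L) : ℝ) * (2484000 * (L : ℝ) ^ 4))) ^ 2 / 4))) *
              ∫ w : GnoFol L, piWeight (gnoFolBlocks w))) +
        ENNReal.ofReal (Real.exp (-(b * (min (sT ^ 2) (κf / (300 * (L : ℝ) ^ 4)) / (3600 * (L : ℝ) ^ 6))))) *
          ∫⁻ F : Fol L → Fin 3 → ℝ, ENNReal.ofReal (piWeight F) :=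
  tipFibre_le_of_floor hε hδt hwinδ hA0s hA0yy hA0ray hA0amb x y z hsT hκf0 hs2 hκf hκwin hu p' hD0 hD1 hD hDwin hb _
    (fun F => four_cross_floor δt ε x y z F)

end Summit.QuantumFields.YangMills.Theorems.SwapVirialDeficit.SectorLaplace

end
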